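import Literature.NumberTheory.Rogawski1990.LocalTransferTorusSingularSideSumsCM           -- ★ F0P2-p02 (g8): the sided sums at a torus point (FILE 1)
import Literature.NumberTheory.Rogawski1990.LocalTransferChartRealisationPointwise         -- ★ F0P2-p02 (g8): realisation with `P` only at the evaluation point
import HarnessLib

/-!
# THE TORUS–SINGULAR JUNCTION AT THE CM CARRIERS, FILE 2 — `R_φ` is a local stable orbital integral at `ε_H = (A_{a,b}, a)` (H-regular, G-singular)
# (Rogawski 1990 Prop. 8.2.1 (c); Langlands–Shelstad descent §2.4; Labesse–Langlands rank one), HYPOTHESIS-DRIVEN on the descent ∕ rank-one data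

Topic `NumberTheory/Rogawski1990`; namespace `Literature.NumberTheory.Rogawski1990`.  FILE 2 of 2: ONE THEOREM (no definition, no instance, no notation, no named fact, no
`sorry`).  Cell `pub/hodgecm-mathlib` (D-0151), crux H413 = stmt-HodgeConjecture-24833, floor-2 line «N6nsGerm» (stub `stub_N6nsS2`), LEAD F0P3a-plan (g9) WORD T8-78
«(α″) S2 JUNCTION»; seat F0P2-p02 (g8) (pen of the line).  HONEST LABEL: HC_CM is proved only modulo the printed citations until rung 0 closes; this file proves
`stub_N6nsS2` ONLY MODULO ITS BINDERS (torus chart at `ε_H`, torus Haar normalisation, central dock of `H♭ := Z_{G′}(ε)` and torus transport `τ`, SEP′ and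
side-disjointness, SIDED uniform fibre, DESCENT at `ε` (the S1 object, same tokens, base point `ε♭`), SATURATION at `ε♭`, the rank-one ENDOSCOPIC transfer in
locally-constant-extension dress (R1-lc), and the compact-side vanishing).  The mathematics is in FILE 1's header; here: gather the neighbourhoods, realise the locally
constant `g` on the torus box by ★ `IsCanonical.exists_isLocSmooth_stableOrbitalIntegralRel_eq_of_chart_of_mem` (pointwise-admissible: the box meets the `G`-singular
hypersurface), leave the torus by conjugation invariance (★ `hl`, ★ `stableOrbitalIntegralRel_congr_of_rel`), and read FILE 1's torus-point identity.

## References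
* [Rogawski1990] J. Rogawski, *Automorphic Representations of Unitary Groups in Three Variables*, Ann. of Math. Stud. 123 (1990): §8.2 Prop. 8.2.1 (c) pp. 113–115; §4.9 Lemma 4.9.3 p. 56; §4.3 (4.3.1) p. 43.
* [LanglandsShelstad1990Descent] R. P. Langlands, D. Shelstad, *Descent for transfer factors* (1990): §2.4.
* [LabesseLanglands1979] J.-P. Labesse, R. P. Langlands, *L-indistinguishability for SL(2)*, Canad. J. Math. 31 (1979): §2 (the rank-one input (R1), a binder here).
-/

set_option autoImplicit false

noncomputable section

open Set Filter Topology MeasureTheory Polynomial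
open scoped Pointwise Matrix

namespace Literature.NumberTheory.Rogawski1990

open Literature.NumberTheory.Automorphic Literature.NumberTheory.Automorphic.UnitaryGroup Literature.NumberTheory.GaloisRepresentations
open _root_.NumberField _root_.IsDedekindDomain

section TorusSingularJunction

variable (L : Type) [Field L] [NumberField L] [IsCMField L] (H' : Matrix (Fin 3) (Fin 3) L) (v : HeightOneSpectrum (𝓞 ↥(maximalRealSubfield L)))
  [iM' : ∀ γ : (cmDatum L 3 H').Local v, MeasurableSpace ((cmDatum L 3 H').Local v ⧸ Subgroup.centralizer ({γ} : Set ((cmDatum L 3 H').Local v)))]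
  [iH : ∀ a : ((cmDatum L 2 (Matrix.of fun i j : Fin 2 => if i.val + j.val + 1 = 2 then (1 : L) else 0)).Local v ×
      (cmDatum L 1 (Matrix.of fun i j : Fin 1 => if i.val + j.val + 1 = 1 then (1 : L) else 0)).Local v), MeasurableSpace (((cmDatum L 2 (Matrix.of fun i j : Fin 2 => if i.val + j.val + 1 = 2 then (1 : L) else 0)).Local v ×
      (cmDatum L 1 (Matrix.of fun i j : Fin 1 => if i.val + j.val + 1 = 1 then (1 : L) else 0)).Local v) ⧸ Subgroup.centralizer ({a} : Set ((cmDatum L 2 (Matrix.of fun i j : Fin 2 => if i.val + j.val + 1 = 2 then (1 : L) else 0)).Local v ×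
      (cmDatum L 1 (Matrix.of fun i j : Fin 1 => if i.val + j.val + 1 = 1 then (1 : L) else 0)).Local v)))]

variable [MeasurableSpace ((cmDatum L 2 (Matrix.of fun i j : Fin 2 => if i.val + j.val + 1 = 2 then (1 : L) else 0)).Local v ×
      (cmDatum L 1 (Matrix.of fun i j : Fin 1 => if i.val + j.val + 1 = 1 then (1 : L) else 0)).Local v)] [BorelSpace ((cmDatum L 2 (Matrix.of fun i j : Fin 2 => if i.val + j.val + 1 = 2 then (1 : L) else 0)).Local v ×
      (cmDatum L 1 (Matrix.of fun i j : Fin 1 => if i.val + j.val + 1 = 1 then (1 : L) else 0)).Local v)]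
  [iHB : ∀ a : ((cmDatum L 2 (Matrix.of fun i j : Fin 2 => if i.val + j.val + 1 = 2 then (1 : L) else 0)).Local v ×
      (cmDatum L 1 (Matrix.of fun i j : Fin 1 => if i.val + j.val + 1 = 1 then (1 : L) else 0)).Local v), BorelSpace (((cmDatum L 2 (Matrix.of fun i j : Fin 2 => if i.val + j.val + 1 = 2 then (1 : L) else 0)).Local v ×
      (cmDatum L 1 (Matrix.of fun i j : Fin 1 => if i.val + j.val + 1 = 1 then (1 : L) else 0)).Local v) ⧸ Subgroup.centralizer ({a} : Set ((cmDatum L 2 (Matrix.of fun i j : Fin 2 => if i.val + j.val + 1 = 2 then (1 : L) else 0)).Local v ×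
      (cmDatum L 1 (Matrix.of fun i j : Fin 1 => if i.val + j.val + 1 = 1 then (1 : L) else 0)).Local v)))]

set_option maxHeartbeats 400000 in
/-- **`R_φ` IS A LOCAL STABLE ORBITAL INTEGRAL AT AN H-REGULAR, G-SINGULAR POINT `ε_H = (A_{a,b}, a)` — the body of `stub_N6nsS2`, HYPOTHESIS-DRIVEN (Rogawski 1990
Prop. 8.2.1 (c)).**  Data: the explicit `Δ_v`, canonical `mH`; `ε_H` with `A = ε_H.1` regular semisimple; the TORUS CHART at `ε_H` in the coordinates of `T_H = Z_H(ε_H)` with shrinking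
(`hNH`, A-p16 (2ᵀ′)) and the normalised torus Haar `ρ` (`hTc`, `hρ`, B-p04 (o3′)); the good class `ε` with the DOCK `θ : H_v ≃ₜ* Z_{G′}(ε)` of `H♭`, its base point `εf` and the
TORUS TRANSPORT `τ : T_H → H_v` (`τ b₀ = εf`, continuous, `G`-regularity preserved); the bad class base point `εb′`; binders `hsep′` (SEP′), `hdisj`, `hUs` (SIDED uniform fibre:
matched classes of a `G`-regular torus point `t` near `ε_H` are conjugate into `θ(B)` at a point `H♭`-stably conjugate to `τ t`, or into `B′`), `hD` (DESCENT at `ε` — the S1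
object at `εf`), `hsat` (SATURATION at `εf`), `hR1` ((R1-lc): the weighted ε-side sum is the restriction of a locally constant function on the torus near `b₀`), `hI0` (the
`ε′`-side vanishes near `b₀`).  CONCLUSION: `∃ V ∈ 𝓝 ε_H, ∃ φ^H ∈ C_c^∞(H_v)`, `Φ^st_H(γ_H, φ^H) = Σᶠ_c Δ_v(γ_H, c)·Φ(c, φ)` for all `G`-regular `γ_H ∈ V` — `stub_N6nsS2`'s body at
`T := (finExplicitCollection μ) v`. [cite: Rogawski1990, §8.2 Prop. 8.2.1 (c) pp. 113–115; §4.9 Lemma 4.9.3 p. 56; §4.3 (4.3.1) p. 43] [cite: LanglandsShelstad1990Descent, §2.4]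
[cite: LabesseLanglands1979, §2] -/
theorem exists_nhds_stableOrbitalIntegralRel_eq_of_torus_singular
    (hH' : (H'.map (cmConjRingHom L))ᵀ = H') (hdet' : H'.det ≠ 0) (μ : HeckeCharacter L)
    (hl : ∀ (v : HeightOneSpectrum (𝓞 ↥(maximalRealSubfield L))) (a : ((cmDatum L 2 (Matrix.of fun i j : Fin 2 => if i.val + j.val + 1 = 2 then (1 : L) else 0)).Local v ×
      (cmDatum L 1 (Matrix.of fun i j : Fin 1 => if i.val + j.val + 1 = 1 then (1 : L) else 0)).Local v)) (b : (cmDatum L 3 H').Local v) (x : ((cmDatum L 2 (Matrix.of fun i j : Fin 2 => if i.val + j.val + 1 = 2 then (1 : L) else 0)).Local v ×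
      (cmDatum L 1 (Matrix.of fun i j : Fin 1 => if i.val + j.val + 1 = 1 then (1 : L) else 0)).Local v)),
      finExplicitDelta L v H' (x * a * x⁻¹) μ b = finExplicitDelta L v H' a μ b)
    (hr : ∀ (v : HeightOneSpectrum (𝓞 ↥(maximalRealSubfield L))) (a : ((cmDatum L 2 (Matrix.of fun i j : Fin 2 => if i.val + j.val + 1 = 2 then (1 : L) else 0)).Local v ×
      (cmDatum L 1 (Matrix.of fun i j : Fin 1 => if i.val + j.val + 1 = 1 then (1 : L) else 0)).Local v)) (b y : (cmDatum L 3 H').Local v),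
      finExplicitDelta L v H' a μ (y * b * y⁻¹) = finExplicitDelta L v H' a μ b)
    (νH : Measure ((cmDatum L 2 (Matrix.of fun i j : Fin 2 => if i.val + j.val + 1 = 2 then (1 : L) else 0)).Local v ×
      (cmDatum L 1 (Matrix.of fun i j : Fin 1 => if i.val + j.val + 1 = 1 then (1 : L) else 0)).Local v)) [νH.IsHaarMeasure] [νH.IsMulRightInvariant]
    {mH : OrbitalMeasureFamily ((cmDatum L 2 (Matrix.of fun i j : Fin 2 => if i.val + j.val + 1 = 2 then (1 : L) else 0)).Local v ×
      (cmDatum L 1 (Matrix.of fun i j : Fin 1 => if i.val + j.val + 1 = 1 then (1 : L) else 0)).Local v)} {mG : OrbitalMeasureFamily ((cmDatum L 3 H').Local v)}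
    (hmH : mH.IsCanonical (IsLocalGRegular L v) νH)
    -- the H-regular, G-singular point and its torus
    (εH : ((cmDatum L 2 (Matrix.of fun i j : Fin 2 => if i.val + j.val + 1 = 2 then (1 : L) else 0)).Local v ×
      (cmDatum L 1 (Matrix.of fun i j : Fin 1 => if i.val + j.val + 1 = 1 then (1 : L) else 0)).Local v))
    (hTc : IsClosed ((Subgroup.centralizer ({εH} : Set ((cmDatum L 2 (Matrix.of fun i j : Fin 2 => if i.val + j.val + 1 = 2 then (1 : L) else 0)).Local v ×
      (cmDatum L 1 (Matrix.of fun i j : Fin 1 => if i.val + j.val + 1 = 1 then (1 : L) else 0)).Local v)) : Subgroup ((cmDatum L 2 (Matrix.of fun i j : Fin 2 => if i.val + j.val + 1 = 2 then (1 : L) else 0)).Local v ×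
      (cmDatum L 1 (Matrix.of fun i j : Fin 1 => if i.val + j.val + 1 = 1 then (1 : L) else 0)).Local v)) : Set ((cmDatum L 2 (Matrix.of fun i j : Fin 2 => if i.val + j.val + 1 = 2 then (1 : L) else 0)).Local v ×
      (cmDatum L 1 (Matrix.of fun i j : Fin 1 => if i.val + j.val + 1 = 1 then (1 : L) else 0)).Local v)))
    [MeasurableSpace (((cmDatum L 2 (Matrix.of fun i j : Fin 2 => if i.val + j.val + 1 = 2 then (1 : L) else 0)).Local v ×
      (cmDatum L 1 (Matrix.of fun i j : Fin 1 => if i.val + j.val + 1 = 1 then (1 : L) else 0)).Local v) ⧸ Subgroup.centralizer ({εH} : Set ((cmDatum L 2 (Matrix.of fun i j : Fin 2 => if i.val + j.val + 1 = 2 then (1 : L) else 0)).Local v ×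
      (cmDatum L 1 (Matrix.of fun i j : Fin 1 => if i.val + j.val + 1 = 1 then (1 : L) else 0)).Local v)))] [BorelSpace (((cmDatum L 2 (Matrix.of fun i j : Fin 2 => if i.val + j.val + 1 = 2 then (1 : L) else 0)).Local v ×
      (cmDatum L 1 (Matrix.of fun i j : Fin 1 => if i.val + j.val + 1 = 1 then (1 : L) else 0)).Local v) ⧸ Subgroup.centralizer ({εH} : Set ((cmDatum L 2 (Matrix.of fun i j : Fin 2 => if i.val + j.val + 1 = 2 then (1 : L) else 0)).Local v ×
      (cmDatum L 1 (Matrix.of fun i j : Fin 1 => if i.val + j.val + 1 = 1 then (1 : L) else 0)).Local v)))]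
    (ρ : Measure ↥(Subgroup.centralizer ({εH} : Set ((cmDatum L 2 (Matrix.of fun i j : Fin 2 => if i.val + j.val + 1 = 2 then (1 : L) else 0)).Local v ×
      (cmDatum L 1 (Matrix.of fun i j : Fin 1 => if i.val + j.val + 1 = 1 then (1 : L) else 0)).Local v)))) [ρ.IsHaarMeasure] [ρ.IsInvInvariant] (hρ : ρ (compactCore ↥(Subgroup.centralizer ({εH} : Set ((cmDatum L 2 (Matrix.of fun i j : Fin 2 => if i.val + j.val + 1 = 2 then (1 : L) else 0)).Local v ×
      (cmDatum L 1 (Matrix.of fun i j : Fin 1 => if i.val + j.val + 1 = 1 then (1 : L) else 0)).Local v)))) = 1)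
    -- (2ᵀ′) the torus chart at `ε_H`, with shrinking
    {AH : Type*} [TopologicalSpace AH] (sH : AH → ((cmDatum L 2 (Matrix.of fun i j : Fin 2 => if i.val + j.val + 1 = 2 then (1 : L) else 0)).Local v ×
      (cmDatum L 1 (Matrix.of fun i j : Fin 1 => if i.val + j.val + 1 = 1 then (1 : L) else 0)).Local v)) (eH : OpenPartialHomeomorph (AH × ↥(Subgroup.centralizer ({εH} : Set ((cmDatum L 2 (Matrix.of fun i j : Fin 2 => if i.val + j.val + 1 = 2 then (1 : L) else 0)).Local v ×
      (cmDatum L 1 (Matrix.of fun i j : Fin 1 => if i.val + j.val + 1 = 1 then (1 : L) else 0)).Local v)))) ((cmDatum L 2 (Matrix.of fun i j : Fin 2 => if i.val + j.val + 1 = 2 then (1 : L) else 0)).Local v ×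
      (cmDatum L 1 (Matrix.of fun i j : Fin 1 => if i.val + j.val + 1 = 1 then (1 : L) else 0)).Local v)) (aH : AH) (b₀ : ↥(Subgroup.centralizer ({εH} : Set ((cmDatum L 2 (Matrix.of fun i j : Fin 2 => if i.val + j.val + 1 = 2 then (1 : L) else 0)).Local v ×
      (cmDatum L 1 (Matrix.of fun i j : Fin 1 => if i.val + j.val + 1 = 1 then (1 : L) else 0)).Local v))))
    (heH : ∀ p ∈ eH.source, eH p = sH p.1 * (p.2 : ((cmDatum L 2 (Matrix.of fun i j : Fin 2 => if i.val + j.val + 1 = 2 then (1 : L) else 0)).Local v ×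
      (cmDatum L 1 (Matrix.of fun i j : Fin 1 => if i.val + j.val + 1 = 1 then (1 : L) else 0)).Local v)) * (sH p.1)⁻¹) (hsHc : Continuous sH) (hsH₁ : sH aH = 1) (hb₀ : (b₀ : ((cmDatum L 2 (Matrix.of fun i j : Fin 2 => if i.val + j.val + 1 = 2 then (1 : L) else 0)).Local v ×
      (cmDatum L 1 (Matrix.of fun i j : Fin 1 => if i.val + j.val + 1 = 1 then (1 : L) else 0)).Local v)) = εH)
    (hNH : ∀ N ∈ 𝓝 (aH, b₀), ∃ (K : Set AH) (B₁ : Set ↥(Subgroup.centralizer ({εH} : Set ((cmDatum L 2 (Matrix.of fun i j : Fin 2 => if i.val + j.val + 1 = 2 then (1 : L) else 0)).Local v ×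
      (cmDatum L 1 (Matrix.of fun i j : Fin 1 => if i.val + j.val + 1 = 1 then (1 : L) else 0)).Local v)))), IsCompact K ∧ IsOpen K ∧ aH ∈ K ∧ IsCompact B₁ ∧ IsOpen B₁ ∧ b₀ ∈ B₁ ∧
      K ×ˢ B₁ ⊆ N ∧ K ×ˢ B₁ ⊆ eH.source ∧
      (∀ t ∈ B₁, Subgroup.centralizer ({(t : ((cmDatum L 2 (Matrix.of fun i j : Fin 2 => if i.val + j.val + 1 = 2 then (1 : L) else 0)).Local v ×
      (cmDatum L 1 (Matrix.of fun i j : Fin 1 => if i.val + j.val + 1 = 1 then (1 : L) else 0)).Local v))} : Set ((cmDatum L 2 (Matrix.of fun i j : Fin 2 => if i.val + j.val + 1 = 2 then (1 : L) else 0)).Local v ×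
      (cmDatum L 1 (Matrix.of fun i j : Fin 1 => if i.val + j.val + 1 = 1 then (1 : L) else 0)).Local v)) = Subgroup.centralizer ({εH} : Set ((cmDatum L 2 (Matrix.of fun i j : Fin 2 => if i.val + j.val + 1 = 2 then (1 : L) else 0)).Local v ×
      (cmDatum L 1 (Matrix.of fun i j : Fin 1 => if i.val + j.val + 1 = 1 then (1 : L) else 0)).Local v))) ∧
      (∀ t ∈ B₁, ∀ x : ((cmDatum L 2 (Matrix.of fun i j : Fin 2 => if i.val + j.val + 1 = 2 then (1 : L) else 0)).Local v ×
      (cmDatum L 1 (Matrix.of fun i j : Fin 1 => if i.val + j.val + 1 = 1 then (1 : L) else 0)).Local v), x * (t : ((cmDatum L 2 (Matrix.of fun i j : Fin 2 => if i.val + j.val + 1 = 2 then (1 : L) else 0)).Local v ×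
      (cmDatum L 1 (Matrix.of fun i j : Fin 1 => if i.val + j.val + 1 = 1 then (1 : L) else 0)).Local v)) * x⁻¹ ∈ eH '' (K ×ˢ B₁) →
        x ∈ sH '' K * ((Subgroup.centralizer ({εH} : Set ((cmDatum L 2 (Matrix.of fun i j : Fin 2 => if i.val + j.val + 1 = 2 then (1 : L) else 0)).Local v ×
      (cmDatum L 1 (Matrix.of fun i j : Fin 1 => if i.val + j.val + 1 = 1 then (1 : L) else 0)).Local v)) : Subgroup ((cmDatum L 2 (Matrix.of fun i j : Fin 2 => if i.val + j.val + 1 = 2 then (1 : L) else 0)).Local v ×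
      (cmDatum L 1 (Matrix.of fun i j : Fin 1 => if i.val + j.val + 1 = 1 then (1 : L) else 0)).Local v)) : Set ((cmDatum L 2 (Matrix.of fun i j : Fin 2 => if i.val + j.val + 1 = 2 then (1 : L) else 0)).Local v ×
      (cmDatum L 1 (Matrix.of fun i j : Fin 1 => if i.val + j.val + 1 = 1 then (1 : L) else 0)).Local v))) ∧
      (∀ t ∈ B₁, ∀ t' ∈ B₁, IsLocalStablyConjH L v (t : ((cmDatum L 2 (Matrix.of fun i j : Fin 2 => if i.val + j.val + 1 = 2 then (1 : L) else 0)).Local v ×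
      (cmDatum L 1 (Matrix.of fun i j : Fin 1 => if i.val + j.val + 1 = 1 then (1 : L) else 0)).Local v)) (t' : ((cmDatum L 2 (Matrix.of fun i j : Fin 2 => if i.val + j.val + 1 = 2 then (1 : L) else 0)).Local v ×
      (cmDatum L 1 (Matrix.of fun i j : Fin 1 => if i.val + j.val + 1 = 1 then (1 : L) else 0)).Local v)) → t = t'))
    -- the dock of `H♭ = Z_{G′}(ε)`, its base point, and the torus transport
    (ε : (cmDatum L 3 H').Local v) (θ : ((cmDatum L 2 (Matrix.of fun i j : Fin 2 => if i.val + j.val + 1 = 2 then (1 : L) else 0)).Local v ×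
      (cmDatum L 1 (Matrix.of fun i j : Fin 1 => if i.val + j.val + 1 = 1 then (1 : L) else 0)).Local v) ≃ₜ* ↥(Subgroup.centralizer ({ε} : Set ((cmDatum L 3 H').Local v)))) (εf : ((cmDatum L 2 (Matrix.of fun i j : Fin 2 => if i.val + j.val + 1 = 2 then (1 : L) else 0)).Local v ×
      (cmDatum L 1 (Matrix.of fun i j : Fin 1 => if i.val + j.val + 1 = 1 then (1 : L) else 0)).Local v)) (τ : ↥(Subgroup.centralizer ({εH} : Set ((cmDatum L 2 (Matrix.of fun i j : Fin 2 => if i.val + j.val + 1 = 2 then (1 : L) else 0)).Local v ×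
      (cmDatum L 1 (Matrix.of fun i j : Fin 1 => if i.val + j.val + 1 = 1 then (1 : L) else 0)).Local v))) → ((cmDatum L 2 (Matrix.of fun i j : Fin 2 => if i.val + j.val + 1 = 2 then (1 : L) else 0)).Local v ×
      (cmDatum L 1 (Matrix.of fun i j : Fin 1 => if i.val + j.val + 1 = 1 then (1 : L) else 0)).Local v)) (hτc : Continuous τ) (hτ₀ : τ b₀ = εf)
    (hτreg : ∀ t : ↥(Subgroup.centralizer ({εH} : Set ((cmDatum L 2 (Matrix.of fun i j : Fin 2 => if i.val + j.val + 1 = 2 then (1 : L) else 0)).Local v ×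
      (cmDatum L 1 (Matrix.of fun i j : Fin 1 => if i.val + j.val + 1 = 1 then (1 : L) else 0)).Local v))), IsLocalGRegular L v (t : ((cmDatum L 2 (Matrix.of fun i j : Fin 2 => if i.val + j.val + 1 = 2 then (1 : L) else 0)).Local v ×
      (cmDatum L 1 (Matrix.of fun i j : Fin 1 => if i.val + j.val + 1 = 1 then (1 : L) else 0)).Local v)) → IsLocalGRegular L v (τ t))
    -- the bad class base point
    (ε' : (cmDatum L 3 H').Local v) (εb' : ↥(Subgroup.centralizer ({ε'} : Set ((cmDatum L 3 H').Local v))))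
    -- (SEP′) transported, and side-disjointness
    (hsep' : ∃ B₇ ∈ 𝓝 εf, ∀ h ∈ B₇, ∀ h' ∈ B₇, ∀ x : (cmDatum L 3 H').Local v, x * ((θ h : ↥(Subgroup.centralizer ({ε} : Set ((cmDatum L 3 H').Local v)))) : (cmDatum L 3 H').Local v) * x⁻¹ = ((θ h' : ↥(Subgroup.centralizer ({ε} : Set ((cmDatum L 3 H').Local v)))) : (cmDatum L 3 H').Local v) → IsConj h h')
    (hdisj : ∃ B₀ ∈ 𝓝 εf, ∃ B₀' ∈ 𝓝 εb', ∀ h ∈ B₀, ∀ m' ∈ B₀', ∀ x : (cmDatum L 3 H').Local v, x * ((θ h : ↥(Subgroup.centralizer ({ε} : Set ((cmDatum L 3 H').Local v)))) : (cmDatum L 3 H').Local v) * x⁻¹ ≠ (m' : (cmDatum L 3 H').Local v))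
    -- (U-s″) the SIDED uniform fibre at `ε_H`
    (hUs : ∀ B ∈ 𝓝 εf, ∀ B' ∈ 𝓝 εb', ∃ V ∈ 𝓝 b₀, ∀ t ∈ V, IsLocalGRegular L v (t : ((cmDatum L 2 (Matrix.of fun i j : Fin 2 => if i.val + j.val + 1 = 2 then (1 : L) else 0)).Local v ×
      (cmDatum L 1 (Matrix.of fun i j : Fin 1 => if i.val + j.val + 1 = 1 then (1 : L) else 0)).Local v)) → ∀ γ' : (cmDatum L 3 H').Local v, IsLocalNormPair L H' v (t : ((cmDatum L 2 (Matrix.of fun i j : Fin 2 => if i.val + j.val + 1 = 2 then (1 : L) else 0)).Local v ×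
      (cmDatum L 1 (Matrix.of fun i j : Fin 1 => if i.val + j.val + 1 = 1 then (1 : L) else 0)).Local v)) γ' →
      (∃ x : (cmDatum L 3 H').Local v, ∃ h ∈ B, IsLocalStablyConjH L v (τ t) h ∧ x * γ' * x⁻¹ = ((θ h : ↥(Subgroup.centralizer ({ε} : Set ((cmDatum L 3 H').Local v)))) : (cmDatum L 3 H').Local v)) ∨
      (∃ x : (cmDatum L 3 H').Local v, ∃ m' ∈ B', x * γ' * x⁻¹ = (m' : (cmDatum L 3 H').Local v)))
    -- (D2ε) DESCENT at `ε` read on `H♭ = H_v` through `θ` — the S1 object, base point `εf`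
    (hD : ∀ ψ : (cmDatum L 3 H').Local v → ℂ, IsLocSmooth ψ → ∃ B ∈ 𝓝 εf, ∃ ψε : ((cmDatum L 2 (Matrix.of fun i j : Fin 2 => if i.val + j.val + 1 = 2 then (1 : L) else 0)).Local v ×
      (cmDatum L 1 (Matrix.of fun i j : Fin 1 => if i.val + j.val + 1 = 1 then (1 : L) else 0)).Local v) → ℂ, IsLocSmooth ψε ∧
      ∀ h ∈ B, IsLocalGRegular L v h → classOrbitalIntegral mG ψ (ConjClasses.mk ((θ h : ↥(Subgroup.centralizer ({ε} : Set ((cmDatum L 3 H').Local v)))) : (cmDatum L 3 H').Local v)) = classOrbitalIntegral mH ψε (ConjClasses.mk h))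
    -- (σ-SAT) saturation at `εf`
    (hsat : ∀ V' ∈ 𝓝 εf, ∃ V ∈ 𝓝 εf, ∀ h₀ ∈ V, IsLocalGRegular L v h₀ → ∀ h' : ((cmDatum L 2 (Matrix.of fun i j : Fin 2 => if i.val + j.val + 1 = 2 then (1 : L) else 0)).Local v ×
      (cmDatum L 1 (Matrix.of fun i j : Fin 1 => if i.val + j.val + 1 = 1 then (1 : L) else 0)).Local v), IsLocalStablyConjH L v h₀ h' → ∃ x : ((cmDatum L 2 (Matrix.of fun i j : Fin 2 => if i.val + j.val + 1 = 2 then (1 : L) else 0)).Local v ×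
      (cmDatum L 1 (Matrix.of fun i j : Fin 1 => if i.val + j.val + 1 = 1 then (1 : L) else 0)).Local v), x * h' * x⁻¹ ∈ V')
    -- (R1-lc) the rank-one endoscopic transfer, locally-constant-extension dress
    (hR1 : ∀ ψε : ((cmDatum L 2 (Matrix.of fun i j : Fin 2 => if i.val + j.val + 1 = 2 then (1 : L) else 0)).Local v ×
      (cmDatum L 1 (Matrix.of fun i j : Fin 1 => if i.val + j.val + 1 = 1 then (1 : L) else 0)).Local v) → ℂ, IsLocSmooth ψε → ∃ V ∈ 𝓝 b₀, ∃ g : ↥(Subgroup.centralizer ({εH} : Set ((cmDatum L 2 (Matrix.of fun i j : Fin 2 => if i.val + j.val + 1 = 2 then (1 : L) else 0)).Local v ×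
      (cmDatum L 1 (Matrix.of fun i j : Fin 1 => if i.val + j.val + 1 = 1 then (1 : L) else 0)).Local v))) → ℂ, IsLocallyConstant g ∧
      ∀ t ∈ V, IsLocalGRegular L v (t : ((cmDatum L 2 (Matrix.of fun i j : Fin 2 => if i.val + j.val + 1 = 2 then (1 : L) else 0)).Local v ×
      (cmDatum L 1 (Matrix.of fun i j : Fin 1 => if i.val + j.val + 1 = 1 then (1 : L) else 0)).Local v)) →
        (∑ᶠ d ∈ {d : ConjClasses ((cmDatum L 2 (Matrix.of fun i j : Fin 2 => if i.val + j.val + 1 = 2 then (1 : L) else 0)).Local v ×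
      (cmDatum L 1 (Matrix.of fun i j : Fin 1 => if i.val + j.val + 1 = 1 then (1 : L) else 0)).Local v) | IsLocalStablyConjH L v (τ t) (Quotient.out d)},
          ((finExplicitCollection L H' μ hl hr) v).Δ (t : ((cmDatum L 2 (Matrix.of fun i j : Fin 2 => if i.val + j.val + 1 = 2 then (1 : L) else 0)).Local v ×
      (cmDatum L 1 (Matrix.of fun i j : Fin 1 => if i.val + j.val + 1 = 1 then (1 : L) else 0)).Local v)) ((θ (Quotient.out d) : ↥(Subgroup.centralizer ({ε} : Set ((cmDatum L 3 H').Local v)))) : (cmDatum L 3 H').Local v) * classOrbitalIntegral mH ψε d) = g t)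
    -- (Iε′₀) the compact side vanishes
    (hI0 : ∀ ψ : (cmDatum L 3 H').Local v → ℂ, IsLocSmooth ψ → ∀ B₀' ∈ 𝓝 εb', ∃ B' ∈ 𝓝 εb', B' ⊆ B₀' ∧ ∃ V ∈ 𝓝 b₀,
      ∀ t ∈ V, IsLocalGRegular L v (t : ((cmDatum L 2 (Matrix.of fun i j : Fin 2 => if i.val + j.val + 1 = 2 then (1 : L) else 0)).Local v ×
      (cmDatum L 1 (Matrix.of fun i j : Fin 1 => if i.val + j.val + 1 = 1 then (1 : L) else 0)).Local v)) →
        (∑ᶠ c ∈ {c : ConjClasses ((cmDatum L 3 H').Local v) | ∃ x : (cmDatum L 3 H').Local v, ∃ m' ∈ B', x * Quotient.out c * x⁻¹ = (m' : (cmDatum L 3 H').Local v)},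
          ((finExplicitCollection L H' μ hl hr) v).Δ (t : ((cmDatum L 2 (Matrix.of fun i j : Fin 2 => if i.val + j.val + 1 = 2 then (1 : L) else 0)).Local v ×
      (cmDatum L 1 (Matrix.of fun i j : Fin 1 => if i.val + j.val + 1 = 1 then (1 : L) else 0)).Local v)) (Quotient.out c) * classOrbitalIntegral mG ψ c) = 0)
    (φ : (cmDatum L 3 H').Local v → ℂ) (hφ : IsLocSmooth φ) :
    ∃ V ∈ 𝓝 εH, ∃ φH : ((cmDatum L 2 (Matrix.of fun i j : Fin 2 => if i.val + j.val + 1 = 2 then (1 : L) else 0)).Local v ×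
      (cmDatum L 1 (Matrix.of fun i j : Fin 1 => if i.val + j.val + 1 = 1 then (1 : L) else 0)).Local v) → ℂ, IsLocSmooth φH ∧ ∀ γH ∈ V, IsLocalGRegular L v γH →
      stableOrbitalIntegralRel (IsLocalStablyConjH L v) mH φH γH =
        ∑ᶠ c : ConjClasses ((cmDatum L 3 H').Local v), ((finExplicitCollection L H' μ hl hr) v).Δ γH (Quotient.out c) * classOrbitalIntegral mG φ c := by
  classical
  have hΔT : ∀ (a' : ((cmDatum L 2 (Matrix.of fun i j : Fin 2 => if i.val + j.val + 1 = 2 then (1 : L) else 0)).Local v ×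
      (cmDatum L 1 (Matrix.of fun i j : Fin 1 => if i.val + j.val + 1 = 1 then (1 : L) else 0)).Local v)) (b : (cmDatum L 3 H').Local v), ((finExplicitCollection L H' μ hl hr) v).Δ a' b = finExplicitDelta L v H' a' μ b :=
    fun a' b => finExplicitCollection_Δ L H' μ hl hr v a' b
  -- descent, separation, disjointness, the ε-side box `B ∋ εf`
  obtain ⟨B₄, hB₄, φε, hφε, hdesc⟩ := hD φ hφ
  obtain ⟨B₇, hB₇, hsep⟩ := hsep'
  obtain ⟨B₀, hB₀, B₀', hB₀', hdj⟩ := hdisj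
  set B : Set ((cmDatum L 2 (Matrix.of fun i j : Fin 2 => if i.val + j.val + 1 = 2 then (1 : L) else 0)).Local v ×
      (cmDatum L 1 (Matrix.of fun i j : Fin 1 => if i.val + j.val + 1 = 1 then (1 : L) else 0)).Local v) := B₄ ∩ B₇ ∩ B₀ with hBdef
  have hB : B ∈ 𝓝 εf := inter_mem (inter_mem hB₄ hB₇) hB₀
  -- the ε′-side, the sided fibre, saturation (pulled back along `τ`), the rank-one extension
  obtain ⟨B', hB', hB'sub, V₆, hV₆, hI⟩ := hI0 φ hφ B₀' hB₀'
  obtain ⟨V₃, hV₃, hside⟩ := hUs B hB B' hB'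
  obtain ⟨V₅, hV₅, hsatB⟩ := hsat B hB
  have hV₅' : τ ⁻¹' V₅ ∈ 𝓝 b₀ := hτc.continuousAt.preimage_mem_nhds (by rw [hτ₀]; exact hV₅)
  obtain ⟨V₈, hV₈, g, hg, hR⟩ := hR1 φε hφε
  -- shrink the torus chart into all of them
  obtain ⟨K, B₁, hKc, hKo, haK, hB₁c, hB₁o, hb₀B, hNB, hKB, hZ, hsatH, hsepH⟩ :=
    hNH _ (prod_mem_nhds univ_mem (inter_mem (inter_mem (inter_mem hV₃ hV₆) hV₅') hV₈))
  have hBW : ∀ t ∈ B₁, t ∈ V₃ ∧ t ∈ V₆ ∧ t ∈ τ ⁻¹' V₅ ∧ t ∈ V₈ := fun t ht => by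
    have h := (hNB (Set.mk_mem_prod haK ht)).2
    exact ⟨h.1.1.1, h.1.1.2, h.1.2, h.2⟩
  -- realisation of `g` on the torus box (pointwise-admissible)
  obtain ⟨ψ, hψ, hreal, -⟩ := OrbitalMeasureFamily.IsCanonical.exists_isLocSmooth_stableOrbitalIntegralRel_eq_of_chart_of_mem
    (fun g x hg => isLocalGRegular_of_isConj (isConj_iff.2 ⟨x, rfl⟩) hg) hmH
    (Subgroup.centralizer ({εH} : Set ((cmDatum L 2 (Matrix.of fun i j : Fin 2 => if i.val + j.val + 1 = 2 then (1 : L) else 0)).Local v ×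
      (cmDatum L 1 (Matrix.of fun i j : Fin 1 => if i.val + j.val + 1 = 1 then (1 : L) else 0)).Local v))) hTc ρ hρ eH sH hsHc Subtype.val heH hKc hKo haK hB₁c hB₁o hKB hZ hsatH
    (IsLocalStablyConjH L v) (fun a x => isStablyConjH_of_isConj (isConj_iff.2 ⟨x, rfl⟩))
    (fun _ _ h => IsStablyConjH.symm h) (fun _ _ _ h h' => IsStablyConjH.trans h h') hsepH g hg
  -- the open set `V := e_H(K × B₁) ∋ ε_H`
  refine ⟨eH '' (K ×ˢ B₁), (eH.isOpen_image_of_subset_source (hKo.prod hB₁o) hKB).mem_nhds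
    ⟨(aH, b₀), Set.mk_mem_prod haK hb₀B, by rw [heH _ (hKB (Set.mk_mem_prod haK hb₀B)), hsH₁, hb₀, one_mul, inv_one, mul_one]⟩, ψ, hψ, ?_⟩
  rintro γH ⟨⟨a₁, t⟩, hp, rfl⟩ hγreg
  have hpK : a₁ ∈ K := (Set.mem_prod.1 hp).1
  have htB : t ∈ B₁ := (Set.mem_prod.1 hp).2
  rw [heH _ (hKB hp)] at hγreg ⊢
  -- down to the torus point `t`
  have htreg : IsLocalGRegular L v (t : ((cmDatum L 2 (Matrix.of fun i j : Fin 2 => if i.val + j.val + 1 = 2 then (1 : L) else 0)).Local v ×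
      (cmDatum L 1 (Matrix.of fun i j : Fin 1 => if i.val + j.val + 1 = 1 then (1 : L) else 0)).Local v)) :=
    isLocalGRegular_of_isConj (isConj_iff.2 ⟨sH a₁, rfl⟩).symm hγreg
  have hst : IsLocalStablyConjH L v (t : ((cmDatum L 2 (Matrix.of fun i j : Fin 2 => if i.val + j.val + 1 = 2 then (1 : L) else 0)).Local v ×
      (cmDatum L 1 (Matrix.of fun i j : Fin 1 => if i.val + j.val + 1 = 1 then (1 : L) else 0)).Local v)) (sH a₁ * (t : ((cmDatum L 2 (Matrix.of fun i j : Fin 2 => if i.val + j.val + 1 = 2 then (1 : L) else 0)).Local v ×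
      (cmDatum L 1 (Matrix.of fun i j : Fin 1 => if i.val + j.val + 1 = 1 then (1 : L) else 0)).Local v)) * (sH a₁)⁻¹) :=
    isStablyConjH_of_isConj (isConj_iff.2 ⟨sH a₁, rfl⟩)
  have hSO : stableOrbitalIntegralRel (IsLocalStablyConjH L v) mH ψ (sH a₁ * (t : ((cmDatum L 2 (Matrix.of fun i j : Fin 2 => if i.val + j.val + 1 = 2 then (1 : L) else 0)).Local v ×
      (cmDatum L 1 (Matrix.of fun i j : Fin 1 => if i.val + j.val + 1 = 1 then (1 : L) else 0)).Local v)) * (sH a₁)⁻¹) =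
      stableOrbitalIntegralRel (IsLocalStablyConjH L v) mH ψ (t : ((cmDatum L 2 (Matrix.of fun i j : Fin 2 => if i.val + j.val + 1 = 2 then (1 : L) else 0)).Local v ×
      (cmDatum L 1 (Matrix.of fun i j : Fin 1 => if i.val + j.val + 1 = 1 then (1 : L) else 0)).Local v)) := by
    symm
    exact stableOrbitalIntegralRel_congr_of_rel (stA := IsLocalStablyConjH L v) (fun _ _ h => IsStablyConjH.symm h)
      (fun _ _ _ h h' => IsStablyConjH.trans h h') mH ψ hst
  rw [hSO, hreal t htB htreg]
  have hfun : (fun c : ConjClasses ((cmDatum L 3 H').Local v) => ((finExplicitCollection L H' μ hl hr) v).Δ (sH a₁ * (t : ((cmDatum L 2 (Matrix.of fun i j : Fin 2 => if i.val + j.val + 1 = 2 then (1 : L) else 0)).Local v ×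
      (cmDatum L 1 (Matrix.of fun i j : Fin 1 => if i.val + j.val + 1 = 1 then (1 : L) else 0)).Local v)) * (sH a₁)⁻¹) (Quotient.out c) *
      classOrbitalIntegral mG φ c) = fun c => ((finExplicitCollection L H' μ hl hr) v).Δ (t : ((cmDatum L 2 (Matrix.of fun i j : Fin 2 => if i.val + j.val + 1 = 2 then (1 : L) else 0)).Local v ×
      (cmDatum L 1 (Matrix.of fun i j : Fin 1 => if i.val + j.val + 1 = 1 then (1 : L) else 0)).Local v)) (Quotient.out c) * classOrbitalIntegral mG φ c :=
    funext fun c => by rw [hΔT, hΔT, hl]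
  rw [hfun]
  -- the torus-point identity: split, kill the ε′-side, re-index the ε-side, apply (R1-lc)
  obtain ⟨ht₃, ht₆, ht₅, ht₈⟩ := hBW t htB
  have hτt : IsLocalGRegular L v (τ t) := hτreg t htreg
  exact (finsum_delta_mul_classOrbitalIntegral_eq_of_sides L H' v hH' hdet' μ hl hr mH mG θ (t : ((cmDatum L 2 (Matrix.of fun i j : Fin 2 => if i.val + j.val + 1 = 2 then (1 : L) else 0)).Local v ×
      (cmDatum L 1 (Matrix.of fun i j : Fin 1 => if i.val + j.val + 1 = 1 then (1 : L) else 0)).Local v)) (τ t) B B' φ φε (g t) htreg hτt hφ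
    (hside t ht₃ htreg) (fun h hhB m' hm' x => hdj h hhB.2 m' (hB'sub hm') x) (hsatB (τ t) ht₅ hτt)
    (fun h hh h' hh' x hx => hsep h hh.1.2 h' hh'.1.2 x hx) (fun h hhB hh => hdesc h hhB.1.1 hh)
    (hR t ht₈ htreg) (hI t ht₆ htreg)).symm

end TorusSingularJunction

end Literature.NumberTheory.Rogawski1990

end
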